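import Summits.BirchSwinnertonDyer.Rank1Residual.Additive.CompanionLambdaShiftThreePW
import Summits.BirchSwinnertonDyer.Rank1Residual.Additive.DicyclicGrowthLawsThree
import Summits.BirchSwinnertonDyer.Rank1Residual.Additive.OmegaDvdMazurTateAddv
import HarnessLib

/-!
# Additive `p = 3`: the Serre-weight / signature DICHOTOMY on `27 ∥ N`, and the DIVISIBILITY of the
# Mazur–Tate elements that DERIVES the leading term `(1 | 2)·3^{n−1}` of the growth dichotomy
# (cell `b2b-bsdres`, lane CLASS-CLOSURE, team o6, planner o6-r1 GEN 7 — FREEZE DRAFT for the class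
#  typer cc-typer-5, asks A-O6-T7 / A-O6-T8; content = o6-r1, placement + names + dedup = the typer) —
# TYPED, EVIDENCE-LABELLED, NOTHING ASSERTED (every node — theorem-candidate or conjecture-candidate —
# is an `@[conjecture] def … : Prop` obligation; the only `theorem`s are projections and kernel arithmetic)

HONEST FRAMING (cell `b2b-bsdres`, verbatim in every file): the goal of the cell is to DELETE the
COMBINATION-SHAPED residual classes of the Birch–Swinnerton-Dyer formula for ALL analytic-rank `≤ 1`
elliptic curves over `ℚ` — "full BSD formula for every rank `≤ 1` curve in class `C`" assembled
STRICTLY from published theorems — so that the rank-`≤ 1` remainder becomes exactly the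
CONSTRUCTION-SHAPED classes, which are TYPED (missing-input `Prop`s), NOT attempted. This is not
"finishing BSD". Lane CLASS-CLOSURE: census output is EVIDENCE / conjecture items with held-out
validation, never a Literature fact; no main conjecture inside any certificate; nothing is booked.

## What is typed here (report of record `HOME/b2b-bsdres-o6-r1/gen7/O6-GEN7.md` §1–§3b; TARGETS §O6 (G7-1)…(G7-5))

INDEXING (as in `O5/O5LayerLaws.lean`): `θ_n = mazurTateElement f 3 n` is the element at LEVEL `3^{n+1}`,
read in `ℚ[G_n]`, `#G_n = 3^n`, `ω_n = (1+T)^{3^n} − 1`; `C_n = ker(G_n → G_{n−1})` has order `3`, generator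
`g`, and `(1 − g)·ℤ₃[G_n] ↔ ω_{n−1}·(ℤ₃[T]/ω_n)`.  At `μ(θ_n) = 0` the image of `1 − g` in
`𝔽₃[G_n] = 𝔽₃[T]/(T^{3^n})` is a unit times `T^{3^{n−1}}`, so `θ_n ∈ (1−g)^e ℤ₃[G_n]` forces `λ(θ_n) ≥ e·3^{n−1}`.

* **(T7) `SignatureDichotomyThree` (THEOREM-CANDIDATE; proof route O6-GEN7 §1).** For `W/ℚ` with `f₃ = 3`
  (`27 ∥ N`) and `W[3]|G_{ℚ₃}` absolutely irreducible (`LocIrrCriterionThree`), the minimal signature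
  `(v₃c₄, v₃c₆, v₃Δ)` is `(2,4,3)` or `(4,7,9)`; the two cases are swapped by the quadratic twist by `−3`,
  which preserves `N`.  In the first case `ρ̄_{W,3}|I₃ ⊗ 𝔽₉ ≅ ω₂⁵ ⊕ ω₂⁷` (Serre weight `6`, NOT finite
  flat), in the second `≅ ω₂ ⊕ ω₂³` (finite flat, Serre weight `2`).  Sources: Manoharmayum 1999,
  Prop. 4.3.1(2) + Remark, Prop. 3.6, Cor. 4.2.3 [corpus: paper:doi-10-4310-mrl-1999-v6-n6-a12 p0009–p0014]
  (`f = 3 ∧` type H ⇒ `W` is a quadratic twist of `y² = x³ ± 3x + 6b`), plus o6-r1's explicit tame-inertia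
  computation with a 3-adic certificate (`gen7/sw/tame_trace_check.py|.out`: `tr ρ̄(σ) = −(ω₂(σ) + ω₂(σ)³)`
  on the `(2,4,3)` family, `= +(…)` on its twist, control `y² = x³ ∓ x` = Serre's supersingular theorem).
  CENSUS: all 153 878 Cremona curves with `27 ∥ N ≤ 5·10⁵`: `LocIrr` signatures = `{(2,4,3): 13 775,
  (4,7,9): 13 775}`, nothing else; the `(−3)`-twist of every O6-FW row is in Cremona at the same `N` with the
  swapped signature (2 724/2 724).  Typed: the signature clause (census-decidable arithmetic) and its
  unconditional Galois consequence `NoGoodCompanionOfDiscValThree` (a good-at-`3` curve has finite flat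
  `A[3]`, Raynaud `e = 1 < p − 1`, so `A[3] ≇ W[3]` when `v₃Δ_min(W) = 3`) — which makes the `v₃Δ = 3` case
  of `CompanionLambdaShiftThreePW` VACUOUS (consistent with cc-eng-3 A-ENG3-3: 0/737 `(2,4,3)` rows have a
  rational companion; kit j130474 0/25, j130595 all scored rows 0 non-rational companions of level `≤ 6000`).
* **(T8-i) `OmegaDvdMazurTateAdditiveThree` (THEOREM-CANDIDATE = O5's T1 `OmegaDvdMazurTateThree` with the
  hypothesis `ClassO5 W 3` weakened to `Addv W 3`; same `U₃`-vanishing reason, `a₃(W) = 0`).**  EVIDENCE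
  (o6-r1 GEN 7 test A, coset sums `Σ_b x((a + b·3^n)/3^{n+1}) = 0` EXACTLY, both branches): 2 724 O6-FW rows
  and 296 O6-dicyclic rows (`f₃ ∈ {3,5}`) and 12 732 O5 cells (`f₃ = 2`, `e ∈ {2,4}`) at levels `27, 81, 243`,
  0 failures (`gen7/tw/cinv_check.out`, `dicy_cinv.out`, `o5b_twist.out`).  `omegaDvdMazurTateThree_of_additive`
  projects it onto T1.
* **(T8-ii) `OmegaSqDvdMazurTateNineThree` (CONJECTURE-candidate with a two-line mechanism; EVIDENCE-labelled)
  and its λ-consequence `LambdaLowerBoundNineThree`.**  For `W` additive at `3`, `f₃ ∈ {2,3}`, potentially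
  supersingular, `W[3]` irreducible, `v₃Δ_min(W) = 9` (Kodaira III* at `f₃ = 2`; IV* at `f₃ = 3`):
  `θ_n(W) ∈ (1−g)² ℤ₍₃₎[G_n]` for every `n ≥ 1`, hence `λ(θ_n) ≥ 2·3^{n−1}` whenever `μ(θ_n) = 0`.
  MECHANISM (o6-r1 GEN 7 §2–§3b, the EXACT TWIST IDENTITY E-TW): such a `W` is the `(−3)`-twist of a curve
  `W₀` of the SAME conductor with `v₃Δ_min(W₀) = 3`, and `θ_n^±(W) = κ'^± · σ_{1−3^n}(1 − g) · tw_ω θ_n^∓(W₀)`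
  in `ℚ[G_n]` with `κ'^± ∈ ℤ₍₃₎^×` INDEPENDENT of `n` — EXACTLY `κ'⁺ = c_∞/2`, `κ'⁻ = −2/c_∞` (`c_∞ = c_∞(W) =
  c_∞(W₀)`; 659/659 O5b pairs, value multisets on O6/O5a pairs consistent), as predicted by Pal's twist-period
  theorem `Ω(E^d) = (ũ/√d)·c_∞(E^d)·Ω⁻(E)` (`d = −3`, `ũ = u₃ = 1` for `W₀ ↦ W` and `u₃ = 3` for `W ↦ W₀` by
  Connell's rule `λ_{v₃} = min{3v₃c₄, 2v₃c₆, v₃Δ} ≥ 6 ∧ v₃c₆ ≠ 5`) and `g(χ₋₃) = i√3` [Pal2012, Thm. 3.2, Prop. 2.4–2.5]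
  — so the `3`-adic unit is a THEOREM-level input, the residual evidence being only the engines' symbol
  normalisation), while
  `θ_n^∓(W₀) ∈ (1−g)ℤ₍₃₎[G_n]` by (T8-i) and integrality (`W₀[3] ≅ W[3] ⊗ χ` irreducible).  EVIDENCE:
  E-TW exactly proportional on 161 O6-FW pairs × levels `9 … 729` × `±` (1 569 cells + 41 zero-both, 0
  failures) and on 659 O5b pairs × `9 … 243` × `±` in both directions (5 177 + 95 each, 0 failures),
  `v₃(κ') = 0` on 820/820 pairs; the mod-`3` consequence at `μ = 0` ("`x(a/3^{n+1}) mod 3` depends only on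
  `a mod 3^n`") on EVERY certified `v₃Δ = 9` row with irreducible `W[3]`: O6-FW `(4,7,9)` 11 451/11 451 cells,
  O5b III*-irr 8 415/8 415, dicyclic IV*-irr 72/72 (levels `27, 81, 243`, both branches), 0 exceptions;
  `v₃Δ = 3` rows and `e = 2` rows are generically NOT in `(1−g)²` (e.g. III-irr at level 243: 1/1 183).
  Reducible `W[3]`: 15 232/15 233 cells, the exception (54a1, odd branch) having a twist source with `μ = −1`
  (rational `3`-torsion) — outside the hypothesis.  CONSEQUENCE: the coefficient `(if v₃Δ = 9 then 2 else 1)`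
  of `O5.GrowthDichotomyLawLocIrrThree` (o5-r1 T9) and of `signedBase` (S1–S4, `SignedPollackShapeThree`) is
  DERIVED from (T8-i, E-TW, `v₃κ' = 0`); the remainder `q_{n−1} + c` stays EVIDENCE.  FALSIFIER: one certified
  row, one layer with `μ(θ_n) = 0` and `λ(θ_n) < 2·3^{n−1}`, or a coefficient of `θ_n/ω_{n−1}` (mod `ω_n/ω_{n−1}`)
  that is not `≡` a multiple of `ω_{n−1}`.
* NOT typed here (needs vocabulary the tree lacks: odd-branch elements, `tw_ω`, `σ_a` on `ℚ[G_n]`): the twist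
  identity E-TW itself (`Additive.TwistIdentityThree` of ask A-O6-T8 — informal spec in O6-GEN7 §2).

References: [Manoharmayum1999] J. Manoharmayum, Math. Res. Lett. 6 (1999) 735–754, Prop. 3.6, 4.3.1, Cor. 4.2.3,
Thm. 5.4.2; [Serre1987] J.-P. Serre, Duke Math. J. 54 (1987) §2 (the recipe `k(ρ̄)`), Prop. 4;
[BreuilConradDiamondTaylor2001] JAMS 14, Introduction (the `f = 27` remark) [corpus: paper:doi-10-1090-s0894-0347-01-00370-8 p0004];
[MazurTate1987] Duke Math. J. 54 §1; [Pollack2003] Def. 6.15, Prop. 6.9–6.10; [Kurihara2002] Thm. 0.1;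
[PollackWeston2011MT] Thm. 1; [Pal2012] V. Pal, Proc. AMS 140 (2012) 1513–1525, Thm. 3.2, Prop. 2.4 (Connell), 2.5
[corpus: paper:arxiv-1012.0094 p0003–p0006].  Cell files: `HOME/cells/o5o6/TARGETS.md` §O6 (G7-1)…(G7-5),
`HOME/b2b-bsdres-o6-r1/gen7/{O6-GEN7.md, sw/, tw/, SHA16SUMS.gen7}`.

## KERNEL STATUS (cc-typer-5 GEN 10 restamp 1, 2026-08-21T23:20Z; statements byte-identical, tags unchanged —
## cc-lead ⟦gen28⟧ (7): a proved node KEEPS `@[conjecture]`, its proof is the audit's proof-of-item)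

THREE of the six nodes below are THEOREMS, proved by cross-cell pool hands of the x11b3 P-POOL (this lane's first
refusal: no objection; census numbers stay EVIDENCE, nothing booked, no mark, O6 OPEN):
* **(T7) `SignatureDichotomyThree` — `signatureDichotomyThree_holds`** (x11b3-p6 GEN 10,
  `Additive/SignatureDichotomyThreeHolds.lean` p305744 + the field-general valuation lemma
  `Additive/WildThreeSignatureLocal.lean` p304828 `valuation_signature_of_wild_shape`). ROUTE ≠ the docstring's
  Manoharmayum classification: TATE'S ALGORITHM at `3` — wild normal forms (`exists_variableChange_b_of_kodairaSymbolAt_wild`),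
  `c₄ = b₂² − 24b₄`, `c₆ = −b₂³ + 36b₂b₄ − 216b₆`, `c₄³ = 1728Δ + c₆²`: under the criterion `3·v₃c₄ = v₃Δ + 3 ∈ {6, 8, 12, 14}`,
  integral only for II (`v₃c₄ = 2`) and IV* (`4`); also `locIrr_three_iff_signature_of_wild`, `not_locIrr_three_of_condExp_eq_four`
  (now unconditional in `f₃`), `not_locIrr_three_of_condExp_eq_five`, `condExp_eq_three_of_locIrr_three_of_three_le`.
  NO Galois statement (inertia characters / Serre weights) is claimed by that file; `NoGoodCompanionOfDiscValThree` OPEN.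
* **(T8-i) `OmegaDvdMazurTateAdditiveThree` — `omegaDvdMazurTateAdditiveThree_holds`** (x11b3-p1 GEN 11,
  `Additive/OmegaDvdMazurTateAddvHolds.lean` p305243, via the node of record `OmegaDvdMazurTateOfAddv` ↦
  `omegaDvdMazurTateOfAddv_holds` at EVERY additive prime and this file's dedup bridge `…_of_ofAddv`): `a_p = 0` at an
  additive prime kills the fibre sums of the plus symbol (`sum_ratPlusSymbol_add_div_eq_zero_of_addv`), whence
  `ω_{n−1} ∣ θ_n` by the tree's three-term computation at one level.
* **(T8-i, λ-form) `LambdaLowerBoundAdditiveThree` — `lambdaLowerBoundAdditiveThree_holds`** (x11b3-p3 GEN 15,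
  `Additive/LambdaLowerBoundAdditiveThreeHolds.lean` p305956: the bridges `…_of_omegaDvdMazurTateAdditiveThree` /
  `…_of_omegaDvdMazurTateOfAddv` — monic division by `ω_{n−1}` in `Λ`, `λ(ω_{n−1}) = 3^{n−1}`, `λ` additive — with the END
  fed by p305243; corollaries `prime_pow_le_lam_of_isScaledMazurTateLift_of_addv`, `lam_eq_one_or_two_of_…_one_of_addv`).
OPEN: `NoGoodCompanionOfDiscValThree` (Serre-weight statement), `OmegaSqDvdMazurTateNineThree` (T8-ii), `LambdaLowerBoundNineThree`.

## TYPER PLACEMENT NOTE (cc-typer-5 GEN 4, typer of record O5 §3.5 / O6 §3.4, 2026-08-21)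
Landed from o6-r1 GEN 7's FREEZE `HOME/b2b-bsdres-o6-r1/gen7/lean/MazurTateDivisibilityThree.lean` (sha16
8cc3c5d4c7b51108, re-issued 12:11Z superseding d0226ee6fd459cfd; asks A-O6-T7 / A-O6-T8; "content = o6-r1,
placement + names + dedup = the typer") VERBATIM below this note; placement `Additive/MazurTateDivisibilityThree.lean`,
names kept. Two typer additions, both OUTSIDE o6-r1's text: (i) one extra `import … Additive.OmegaDvdMazurTateAddv`;
(ii) the appendix `§T` at the end with ONE proved bridge. DEDUP FINDING (typer of record): (T8-i)
`OmegaDvdMazurTateAdditiveThree` is the `p = 3` INSTANCE of the landed node `Additive.OmegaDvdMazurTateOfAddv`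
(p253482, o6-r1 GEN 2's own structural bit, every additive prime `p`): NODE OF RECORD = `OmegaDvdMazurTateOfAddv`;
(T8-i) is kept as o6-r1's `p = 3` evidence carrier and is DERIVED from it in the kernel
(`omegaDvdMazurTateAdditiveThree_of_ofAddv`, §T), so no independent obligation is created — cite the general node.
TYPER CHECK: all six nodes are `@[conjecture]` obligations by their author's choice, including the THEOREM-CANDIDATES
(T7) `SignatureDichotomyThree`, `NoGoodCompanionOfDiscValThree`, (T8-i) and its λ-form `LambdaLowerBoundAdditiveThree`
(published-proof routes named in the docstrings: Manoharmayum 1999 + tame inertia; Raynaud; `U₃`-vanishing) — nothing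
is typed as a theorem until proved, which is the lane rule; (T8-ii) `OmegaSqDvdMazurTateNineThree` /
`LambdaLowerBoundNineThree` are EVIDENCE conjectures (mechanism E-TW with Pal's unit). `NoGoodCompanionOfDiscValThree`
makes the `v₃Δ = 3` branch of `CompanionLambdaShiftThree{,PW}` VACUOUS — recorded; those nodes stay as landed
(supersede, never re-word). NOT TYPED (o6-r1's own ruling, concurred): E-TW `TwistIdentityThree` — odd-branch
symbols `y⁻`, `tw_ω`, `σ_a` on `ℚ[G_n]` are not tree vocabulary. A-O6-T8's doc note on
`MazurTateGrowthDichotomyThree` (leading coefficient `(1 | 2)·3^{n−1}` DERIVED from T8-i + E-TW + `v₃κ' = 0` + T7)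
lands as a separate doc-only proposal. Audit marks expected: `conjecture` 6, `orphan` 3. 0 named Literature facts;
nothing booked; no mark of `RESIDUAL-MAP.md` moves.
-/

set_option autoImplicit false

noncomputable section

open scoped Classical MatrixGroups ModularForm NumberField

open CongruenceSubgroup Polynomial WeierstrassCurve NumberField Literature.NumberTheory.EllipticCurves
  Literature.NumberTheory.EllipticCurves.ModularForms
  Literature.NumberTheory.EllipticCurves.Rank1Residual
  Literature.NumberTheory.EllipticCurves.Rank1Residual.Typed
  Summit.BirchSwinnertonDyer.Rank1Residual.X1.MuLambda

namespace Summit.BirchSwinnertonDyer.Rank1Residual.Additive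

/-! ## §1 (T7) The signature dichotomy on `27 ∥ N` and its unconditional companion consequence -/

/-- **(T7) SIGNATURE DICHOTOMY at `f₃ = 3` under `LocIrr` (THEOREM-CANDIDATE; census-decidable).** For a
globally minimal `W/ℚ` with `f₃(W) = 3` satisfying the `c₄/c₆` criterion for `W[3]|G_{ℚ₃}` irreducible, the
signature `(v₃c₄, v₃c₆, v₃Δ)` is `(2,4,3)` (Kodaira II, Serre weight `6`, `ρ̄|I₃ ⊗ 𝔽₉ ≅ ω₂⁵ ⊕ ω₂⁷`) or
`(4,7,9)` (Kodaira IV*, finite flat, `ρ̄|I₃ ⊗ 𝔽₉ ≅ ω₂ ⊕ ω₂³`).  Proof route: Manoharmayum's classification of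
conductor-`27` type-H curves as quadratic twists of `y² = x³ ± 3x + 6b` (Prop. 4.3.1(2), 3.6) + minimality;
the inertia characters by an explicit tame computation (o6-r1 GEN 7 §1, 3-adic certificate).  CENSUS: 27 550 /
27 550 `LocIrr` curves with `27 ∥ N ≤ 5·10⁵` (13 775 + 13 775).  Nothing asserted. **PROVED 2026-08-21:
`signatureDichotomyThree_holds`** (x11b3-p6 GEN 10, `Additive/SignatureDichotomyThreeHolds.lean` p305744; Tate's
algorithm at `3`, see `## KERNEL STATUS`); statement byte-identical, tag kept.
[cite: Manoharmayum1999, Prop. 4.3.1 and Prop. 3.6] [cite: SilvermanATAEC1994, IV.9.4] -/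
@[conjecture] def SignatureDichotomyThree : Prop :=
  ∀ (W : WeierstrassCurve ℚ) [W.IsElliptic] [W.IsGloballyMinimal],
    condExp W 3 = 3 → LocIrrCriterionThree W →
      (padicValRat 3 W.c₄ = 2 ∧ padicValRat 3 W.c₆ = 4 ∧ padicValRat 3 W.Δ = 3) ∨
        (padicValRat 3 W.c₄ = 4 ∧ padicValRat 3 W.c₆ = 7 ∧ padicValRat 3 W.Δ = 9)

/-- Kernel sanity (PROVED): under the criterion the discriminant entries of the two signatures are forced by
the `c₄` entries (`v₃Δ = 3·v₃c₄ − 3`, `padicValRat_Δ_of_locIrrCriterionThree`). [folklore] -/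
theorem padicValRat_Δ_eq_of_locIrrCriterionThree_c₄ (W : WeierstrassCurve ℚ) [W.IsElliptic]
    (h : LocIrrCriterionThree W) :
    (padicValRat 3 W.c₄ = 2 → padicValRat 3 W.Δ = 3) ∧ (padicValRat 3 W.c₄ = 4 → padicValRat 3 W.Δ = 9) := by
  have := padicValRat_Δ_of_locIrrCriterionThree W h
  constructor <;> intro h4 <;> rw [this, h4] <;> norm_num

/-- **(T7, consequence) NO GOOD-AT-`3` COMPANION when `v₃Δ_min = 3` (THEOREM-CANDIDATE, UNCONDITIONAL route).**
If `f₃(W) = 3`, `W[3]|G_{ℚ₃}` is irreducible and `v₃Δ_min(W) = 3`, then no elliptic curve `A/ℚ` with good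
reduction at `3` has `A[3] ≅ W[3]` as Galois modules: `A[3]` extends to a finite flat group scheme over `ℤ₃`,
whose tame inertia characters are `ω₂^{1,3}` or `{ω⁰, ω¹}` (Raynaud, `e = 1 < p − 1`), while `W[3]|I₃ ⊗ 𝔽₉ ≅
ω₂⁵ ⊕ ω₂⁷` (Serre weight `6`).  Makes the `v₃Δ = 3` case of `CompanionLambdaShiftThreePW` vacuous.  CENSUS
(EVIDENCE): cc-eng-3 A-ENG3-3 0/737 `(2,4,3)` rows with a rational companion; o6-r1 kit j130474 (0/25 rows,
any coefficient field, level `≤ 2 700`). [cite: Serre1987, §2 and Prop. 4] -/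
@[conjecture] def NoGoodCompanionOfDiscValThree : Prop :=
  ∀ (W A : WeierstrassCurve ℚ) [W.IsElliptic] [W.IsGloballyMinimal] [A.IsElliptic] [A.IsGloballyMinimal],
    condExp W 3 = 3 → LocIrr W 3 → padicValInt 3 W.minimalDiscriminantInt = 3 → ¬ IsCompanionThree W A

/-! ## §2 (T8-i) `ω_{n−1} ∣ θ_n` for EVERY additive `W` at `3` -/

/-- **(T8-i) `ω_{n−1} ∣ θ_n(f_W)` in `ℚ[X]` for `n ≥ 1` whenever `W` is ADDITIVE at `3` (THEOREM-CANDIDATE;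
`U₃`-vanishing: `9 ∣ N`, `a₃(W) = 0`).**  O5's T1 with `ClassO5 W 3` weakened to `Addv W 3`.  EVIDENCE (coset
sums exactly `0`, both branches, levels `27, 81, 243`): 2 724 O6-FW + 296 O6-dicyclic rows + 12 732 O5 cells,
0 failures (o6-r1 GEN 7 test A).  Consequence: `λ(θ_n) ≥ 3^{n−1}` (`= 3^{n−1} + λ(u_n)`). Nothing asserted.
**PROVED 2026-08-21: `omegaDvdMazurTateAdditiveThree_holds`** (x11b3-p1 GEN 11, `Additive/OmegaDvdMazurTateAddvHolds.lean`
p305243, through `omegaDvdMazurTateOfAddv_holds` and `omegaDvdMazurTateAdditiveThree_of_ofAddv`); tag kept.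
[cite: MazurTate1987, §1] -/
@[conjecture] def OmegaDvdMazurTateAdditiveThree : Prop :=
  ∀ (W : WeierstrassCurve ℚ) [W.IsElliptic] [W.IsGloballyMinimal] [NeZero (W.conductorNorm ℤ)]
    (f : CuspForm (Gamma0 (W.conductorNorm ℤ)) 2), IsNewformOf W f → Addv W 3 →
    ∀ n : ℕ, 1 ≤ n → (cyclotomicOmega 3 (n - 1)).map (Int.castRingHom ℚ) ∣ mazurTateElement f 3 n

/-- (T8-i) projects onto O5's T1 (`ClassO5 W 3 → Addv W 3`). [folklore] -/
theorem omegaDvdMazurTateThree_of_additive (h : OmegaDvdMazurTateAdditiveThree) :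
    O5.OmegaDvdMazurTateThree := by
  intro W _ _ _ f hf hO5 n hn
  exact h W f hf hO5.2.1 n hn

/-! ## §3 (T8-ii) `θ_n ∈ (1 − g)² ℤ₍₃₎[G_n]` on the `v₃Δ_min = 9` sector, and the λ lower bound -/

/-- **(T8-ii) SQUARE DIVISIBILITY on the finite-flat sector (CONJECTURE-candidate; EVIDENCE-labelled; mechanism
= the exact twist identity E-TW with a `3`-adic UNIT constant, o6-r1 GEN 7 §2–§3b).**  For `W` additive at `3`
with `f₃ ∈ {2, 3}`, potentially supersingular, `W[3]` irreducible and `v₃Δ_min(W) = 9`: for every `n ≥ 1`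
there is a `3`-INTEGRAL `z ∈ ℚ[X]` with `θ_n ≡ ω_{n−1}² · z (mod ω_n)` — i.e. `θ_n(W) ∈ (1−g)²ℤ₍₃₎[G_n]`
(over `ℚ` such a `z` always exists since `ω_{n−1}` is invertible modulo `ω_n/ω_{n−1}`; the content is its
`3`-integrality).  EVIDENCE: integrally on 820 twist pairs (E-TW exact, `v₃κ' = 0`), and mod `3` at `μ = 0` on
11 451 + 8 415 + 72 cells of the certified classes (O6-FW IV*, O5b III*-irr, dicyclic IV*-irr), 0 exceptions.
FALSIFIER: one certified row and layer where `θ_n/ω_{n−1} mod (3, ω_n/ω_{n−1})` is not a multiple of `ω_{n−1}`.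
[cite: MazurTate1987, §1] [cite: Pollack2003, Def. 6.15] [cite: Pal2012, Thm. 3.2] -/
@[conjecture] def OmegaSqDvdMazurTateNineThree : Prop :=
  ∀ (W : WeierstrassCurve ℚ) [W.IsElliptic] [W.IsGloballyMinimal] [NeZero (W.conductorNorm ℤ)]
    (f : CuspForm (Gamma0 (W.conductorNorm ℤ)) 2), IsNewformOf W f → Addv W 3 →
    (condExp W 3 = 2 ∨ condExp W 3 = 3) → (0 < padicValRat 3 W.j ∨ W.j = 0) →
    W.HasIrreducibleModPGaloisRep 3 → padicValInt 3 W.minimalDiscriminantInt = 9 →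
    ∀ n : ℕ, 1 ≤ n → ∃ z : ℚ[X], (∀ i : ℕ, 0 ≤ padicValRat 3 (z.coeff i)) ∧
      (cyclotomicOmega 3 n).map (Int.castRingHom ℚ) ∣
        mazurTateElement f 3 n - (cyclotomicOmega 3 (n - 1)).map (Int.castRingHom ℚ) ^ 2 * z

/-- **(T8-ii, λ-form) `λ(θ_n) ≥ 2·3^{n−1}` at `μ(θ_n) = 0` on the `v₃Δ_min = 9` sector (CONJECTURE-candidate;
same hypotheses; the tree's `Λ`-currency of S1–S4 / PW: `Θ` an integral lift of `3^m θ_n` with `μ(Θ) = m`,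
i.e. `μ(θ_n) = 0`).**  This is exactly the LEADING TERM `2·3^{n−1}` of `signedBase 9 n` and of o5-r1's T9 /
`O5.GrowthDichotomyLawLocIrrThree` at `v₃Δ = 9`, now a consequence of `OmegaSqDvdMazurTateNineThree`
(reduction mod `3`: `θ̄_n = T^{2·3^{n−1}}·(z̄ + T^{3^{n−1}} q̄)` in `𝔽₃[T]`).  EVIDENCE: the 19 938 `μ = 0`
cells above, 0 exceptions; on `v₃Δ_min = 3` rows only `λ ≥ 3^{n−1}` holds generically. Nothing asserted.
[cite: Pollack2003, Prop. 6.9–6.10] [cite: Kurihara2002, Thm. 0.1] -/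
@[conjecture] def LambdaLowerBoundNineThree : Prop :=
  ∀ (W : WeierstrassCurve ℚ) [W.IsElliptic] [W.IsGloballyMinimal] [NeZero (W.conductorNorm ℤ)]
    (f : CuspForm (Gamma0 (W.conductorNorm ℤ)) 2), IsNewformOf W f → Addv W 3 →
    (condExp W 3 = 2 ∨ condExp W 3 = 3) → (0 < padicValRat 3 W.j ∨ W.j = 0) →
    W.HasIrreducibleModPGaloisRep 3 → padicValInt 3 W.minimalDiscriminantInt = 9 →
    ∀ (n m : ℕ) (Θ : IwasawaAlgebra 3), 1 ≤ n → O5.IsScaledMazurTateLift f n m Θ → Θ ≠ 0 → mu Θ = m →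
      2 * 3 ^ (n - 1) ≤ lam Θ

/-- **(T8-i, λ-form) `λ(Θ) ≥ 3^{n−1}` for every integral lift `Θ ≠ 0` of a scaled `θ_n(f_W)`, `W` additive at
`3` (THEOREM-CANDIDATE; from `OmegaDvdMazurTateAdditiveThree`: `Θ = ω_{n−1}·v` with `v ∈ Λ` by monic division,
`λ(ω_{n−1}) = 3^{n−1}`, `λ` additive).** No `μ` hypothesis needed. Nothing asserted. **PROVED 2026-08-21:
`lambdaLowerBoundAdditiveThree_holds`** (x11b3-p3 GEN 15, `Additive/LambdaLowerBoundAdditiveThreeHolds.lean` p305956); tag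
kept. [cite: MazurTate1987, §1] -/
@[conjecture] def LambdaLowerBoundAdditiveThree : Prop :=
  ∀ (W : WeierstrassCurve ℚ) [W.IsElliptic] [W.IsGloballyMinimal] [NeZero (W.conductorNorm ℤ)]
    (f : CuspForm (Gamma0 (W.conductorNorm ℤ)) 2), IsNewformOf W f → Addv W 3 →
    ∀ (n m : ℕ) (Θ : IwasawaAlgebra 3), 1 ≤ n → O5.IsScaledMazurTateLift f n m Θ → Θ ≠ 0 →
      3 ^ (n - 1) ≤ lam Θ

/-- Kernel arithmetic (PROVED): the two λ lower bounds ARE the leading terms of the signed base —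
`signedBase 9 n = 2·3^{n−1} + q_{n−1}` and `signedBase 3 n = 3^{n−1} + q_{n−1}`. [folklore] -/
theorem signedBase_eq_leading_add_kuriharaQ (n : ℕ) :
    signedBase 9 n = 2 * 3 ^ (n - 1) + O5.kuriharaQ (n - 1) ∧
      signedBase 3 n = 3 ^ (n - 1) + O5.kuriharaQ (n - 1) := by
  simp [signedBase]

/-! ## §T Typer appendix (cc-typer-5 GEN 4; outside o6-r1's frozen text): the dedup bridge -/

/-- DEDUP BRIDGE (PROVED): (T8-i) is the `p = 3` instance of the node of record
`Additive.OmegaDvdMazurTateOfAddv` (p253482, every additive prime). [folklore] -/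
theorem omegaDvdMazurTateAdditiveThree_of_ofAddv (h : OmegaDvdMazurTateOfAddv) :
    OmegaDvdMazurTateAdditiveThree := by
  intro W _ _ _ f hf hadd n hn
  haveI : Fact (Nat.Prime 3) := ⟨Nat.prime_three⟩
  exact h W f 3 hf hadd n hn

end Summit.BirchSwinnertonDyer.Rank1Residual.Additive

end
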